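import Summits.BirchSwinnertonDyer.BirchSwinnertonDyer.Theorems.ByReductionTypeAtTwoSupersingularFlatLocalLiftHloc2
import Literature.NumberTheory.EllipticCurves.Greenberg1999.LocalQuotientControlSurjectiveProofs
import HarnessLib

/-!
# COUNT♭@2 door v7: the p. 108 leg is a THEOREM — four PRINT-by-name binders remain
# {Prop. 4.13 (Cassels), Prop. 4.12, pp. 119–120, p. 140 / Kato Thm. 12.4}

Seat `bsd-2adic-ss-1` GEN 14, crux `SupersingularRankZeroAtTwo` (stmt-BirchSwinnertonDyer-19097, route
`ByReductionTypeAtTwo`, rung K4), line `flat_uniform_two` v1, stub (2) `stub_allFlatData`, conjunct COUNT♭@2.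
Door v6 (`SSFlatEC.flatCountTwo_of_print_all`, part 20) took FIVE named facts of Greenberg LNM 1716 §4–§5 by
name; the p. 108 local surjectivity at `v ∤ p` (`Greenberg1999.localQuotient_restriction_surjective ℚ`,
binder `hP108`) is now DISCHARGED in the tree
(`Greenberg1999.localQuotient_restriction_surjective_holds`, file
`Literature/NumberTheory/EllipticCurves/Greenberg1999/LocalQuotientControlSurjectiveProofs.lean`: local
`ℤ_p`-extension + Kummer vanishing Prop. 2.1 + `cd_p = 1` on cocycles, every number field, every
`ℤ_p`-extension), so this door (`flatCountTwo_of_print4`) displays only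
{`hC` Prop. 4.13 (Cassels), `h412` Prop. 4.12, `hcork` pp. 119–120, `hWL` §5 p. 140 / Kato Thm. 12.4} and the
Honda₂ clauses of the line. HONEST FRAMING: nothing about any curve is asserted; the crux's ∀-form stays
MATH-BOUND (F4@(2), μ♭ = 0, Miller); no census cell moves; BSD is not proved by any of this.

References: [GreenbergLNM1716] §4 pp. 104–122, §5 p. 140; [Kato2004Asterisque] Thm. 12.4; [Sprung2012] §7.
-/

set_option autoImplicit false
-- the Theorems namespace of this sub repeats the summit name by design (D-0017 nested layout)
set_option linter.dupNamespace false

noncomputable section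

open scoped Classical NumberField

open NumberField IsDedekindDomain WeierstrassCurve Literature.NumberTheory.EllipticCurves
  Literature.NumberTheory.GaloisRepresentations Literature.NumberTheory.EllipticCurves.ZpExtension
  Literature.NumberTheory.EllipticCurves.Kobayashi2003 Literature.NumberTheory.EllipticCurves.Sprung2017
  Literature.NumberTheory.EllipticCurves.Sprung2012 Literature.NumberTheory.EllipticCurves.Sprung2024
  Literature.NumberTheory.EllipticCurves.IwasawaDual Literature.NumberTheory.EllipticCurves.IwasawaAlgebra
  Literature.NumberTheory.EllipticCurves.GreenbergVatsal2000 Literature.NumberTheory.EllipticCurves.Rank1Residual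
  Summit.BirchSwinnertonDyer.Rank1Residual.X5.O1

namespace Summit.BirchSwinnertonDyer.BirchSwinnertonDyer.Theorems.SSFlatEC

/-- **DOOR v7 — COUNT♭@2 from FOUR named facts of Greenberg LNM 1716 by name and the Honda₂ clauses alone.**
Door v6 (`flatCountTwo_of_print_all`) with its binder `hP108 : Greenberg1999.localQuotient_restriction_surjective ℚ`
(p. 108, local surjectivity at `v ∤ p`) supplied by the tree THEOREM
`Greenberg1999.localQuotient_restriction_surjective_holds`. Displayed named facts: Prop. 4.13 (Cassels),
Prop. 4.12, pp. 119–120, §5 p. 140 (Kato Thm. 12.4). Displayed residue: none.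
[cite: GreenbergLNM1716, §4 Prop. 4.12, Prop. 4.13 / p. 122, pp. 108, 119–120; §5 p. 140]
[cite: Kato2004Asterisque, Thm. 12.4 (1)(2) p. 221] [cite: Sprung2012, §7 Def. 7.9–7.11 (p. 1503)] -/
theorem flatCountTwo_of_print4 (W : WeierstrassCurve ℚ) [W.IsElliptic] [W.IsGloballyMinimal]
    (hss : GoodSS W 2) (κ : ZpExtension ℚ 2) (hκ : κ.IsCyclotomic) {γ : Field.absoluteGaloisGroup ℚ}
    (hγ : κ.IsTopGenerator γ) {v : HeightOneSpectrum (𝓞 ℚ)} (hv : (2 : 𝓞 ℚ) ∈ v.asIdeal)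
    {g : Field.absoluteGaloisGroup (v.adicCompletion ℚ)} {c : ℕ → localPoints W (v.adicCompletion ℚ)}
    (hg : κ.IsTopGenerator (resGalOfEmb (closureEmb (K := ℚ) (v.adicCompletion ℚ)) g))
    (hc : ∀ n, c n ∈ localLayerPointsOfEmb κ (closureEmb (K := ℚ) (v.adicCompletion ℚ)) W n)
    (hTr : ∀ n, 1 ≤ n → localTraceOfEmb κ (closureEmb (K := ℚ) (v.adicCompletion ℚ)) W n (n + 1)
      (c (n + 1)) = W.frobeniusTrace 2 • c n - c (n - 1))
    (hinj : ∀ z₀ : localLayerPointsOfEmb κ (closureEmb (K := ℚ) (v.adicCompletion ℚ)) W 0 →+ ℤ_[2],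
      evalOn W (localLayerPointsOfEmb κ (closureEmb (K := ℚ) (v.adicCompletion ℚ)) W 0) z₀ (c 0) = 0 →
        z₀ = 0)
    (hsat : ∀ a : ℤ_[2],
      (∃ z₀ : localLayerPointsOfEmb κ (closureEmb (K := ℚ) (v.adicCompletion ℚ)) W 0 →+ ℤ_[2],
        evalOn W (localLayerPointsOfEmb κ (closureEmb (K := ℚ) (v.adicCompletion ℚ)) W 0) z₀ (c 0) =
          2 * a) →
      ∃ y : localLayerPointsOfEmb κ (closureEmb (K := ℚ) (v.adicCompletion ℚ)) W 0 →+ ℤ_[2],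
        evalOn W (localLayerPointsOfEmb κ (closureEmb (K := ℚ) (v.adicCompletion ℚ)) W 0) y (c 0) = a)
    (S₀ : Finset (HeightOneSpectrum (𝓞 ℚ)))
    (hgood : ∀ w : HeightOneSpectrum (𝓞 ℚ), w ∉ S₀ → ((2 : ℕ) : 𝓞 ℚ) ∉ w.asIdeal → W.HasGoodReductionAt w)
    -- PRINT BY NAME (four named facts; p. 108 is the theorem `localQuotient_restriction_surjective_holds`)
    (hC : Greenberg1999.casselsSurjectivity_H1Sigma ℚ)
    (h412 : Greenberg1999.prop412_noFiniteSubmodule_H1Sigma_of_rank_one)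
    (hcork : Greenberg1999.h1Sigma_zpCorank_le_degree ℚ)
    (hWL : Greenberg1999.h1SigmaInfty_rank_eq_one) :
    Finite (W.selmerGroupPInfty 2) →
      Finite (EndCoinvariants (conjSharpFlatSelmerInfty W κ (closureEmb (K := ℚ) (v.adicCompletion ℚ))
        (W.frobeniusTrace 2) g c .flat γ - 1)) →
      Nat.card (↥((sharpFlatSelmerInfty W κ (closureEmb (K := ℚ) (v.adicCompletion ℚ))
            (W.frobeniusTrace 2) g c .flat).comap (W.layerToInfty κ 0)) ⧸
          (W.selmerLayer κ 0).addSubgroupOf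
            ((sharpFlatSelmerInfty W κ (closureEmb (K := ℚ) (v.adicCompletion ℚ))
              (W.frobeniusTrace 2) g c .flat).comap (W.layerToInfty κ 0))) *
        Nat.card (MulAction.fixedPoints (Field.absoluteGaloisGroup ℚ) (W.geomPrimaryTorsion 2)) =
      2 ^ (padicValNat 2 W.tamagawaProduct) *
        Nat.card (EndCoinvariants (conjSharpFlatSelmerInfty W κ
          (closureEmb (K := ℚ) (v.adicCompletion ℚ)) (W.frobeniusTrace 2) g c .flat γ - 1)) :=
  flatCountTwo_of_print_all W hss κ hκ hγ hv hg hc hTr hinj hsat S₀ hgood hC h412 hcork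
    Greenberg1999.localQuotient_restriction_surjective_holds hWL

end Summit.BirchSwinnertonDyer.BirchSwinnertonDyer.Theorems.SSFlatEC

end
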